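import Summits.Langlands.Langlands.Theses.NonParallelVoid
import Literature.NumberTheory.Automorphic.ACCAutomorphyLiftingCrystalline
import HarnessLib

/-!
# Sketch — crux-strategist for `NonParallelVoid.VoidToLanglands` (stmt-Langlands-17006)

FIRST LEMMA of the technique behind the Target-fed stub `stub_weakParallelModularity` of line
`satake-sector-cut`: Calegari–Geraghty patching at defect `ℓ₀ = 1` with the torsion local–global
compatibility of ACC+ §§3–5, i.e. the automorphy LIFTING theorem ACC+ Thm 6.1.1 in the
Fontaine–Laffaille crystalline range, here at `n = 2` over an imaginary quadratic field `F`
(a CM field) in PARALLEL weight — typed over the tree's vocabulary and PROVED from the vendored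
named fact `ACCGHLNSTT2023.automorphyLifting_crystalline_weightZero` (weight `λ = 0`, i.e. parallel
gap `1` = Hodge–Tate weights `{0, 1}` at every label; general parallel gap `g` awaits a
`HasWeight λ` predicate — definition debt recorded in the line card).
-/

noncomputable section

open scoped MatrixGroups NumberField Classical
open NumberField IsDedekindDomain Field Filter
open Literature.NumberTheory.GaloisRepresentations Literature.NumberTheory.PAdicHodge
open Literature.NumberTheory.Automorphic

namespace Summit.Langlands.Langlands.Cruxes.VoidToLanglands.SatakeSectorCut.Sketch

/-- **First lemma (signature + proof from the named fact): parallel-weight-zero automorphy lifting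
for `GL₂` over an imaginary quadratic field.**  `F` imaginary quadratic (hence CM: `hCM`), `p ≥ 5`
unramified in `F`, `ρ : Γ_F → GL₂(ℚ̄_p)` unramified a.e., crystalline at `v ∣ p` for Fontaine's
pinned datum with labelled Hodge–Tate weights `{0, 1}` at every label (PARALLEL, gap 1), residual
representation `τ` absolutely irreducible, decomposed generic, enormous and absolutely irreducible
on `Γ_{F(ζ_p)}`, a scalar `τ σ` off `Γ_{F(ζ_p)}`, and RESIDUALLY AUTOMORPHIC of weight zero
(`π₀` cuspidal of weight zero unramified above `p`, `r₀` with HLTT's characterising property of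
`r_ι(π₀)` and the same residual representation) ⇒ `ρ ≅ r_ι(Π)` for a cuspidal `Π` of weight zero.
This is ACC+ Thm 6.1.1 at `n = 2`, `λ = 0` (`n² = 4 < p`, `2n = 4 < p`).
[cite: ACCGHLNSTT2023, Thm. 6.1.1] -/
theorem parallelWeightZeroLifting
    (h611 : ACCGHLNSTT2023.automorphyLifting_crystalline_weightZero) :
    ∀ (F : Type) [Field F] [NumberField F] [Algebra.IsQuadraticExtension ℚ F],
      IsTotallyComplex F → IsCMField F →
      ∀ (hcpt : isCompact_glFiniteIntegralLevel 2 F) (p : ℕ) [Fact p.Prime], 5 ≤ p →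
        Algebra.IsUnramifiedIn (𝓞 F) (Ideal.span {(p : ℤ)}) →
      ∀ (ι : PadicAlgCl p ≃+* ℂ) (ρ : FramedGaloisRep F (PadicAlgCl p) 2)
        (τ : absoluteGaloisGroup F →* GL (Fin 2) (padicAlgClResidueField p))
        (π₀ : CuspidalAutomorphicRepData 2 F hcpt) (r₀ : FramedGaloisRep F (PadicAlgCl p) 2),
        (∀ᶠ v : HeightOneSpectrum (𝓞 F) in cofinite, ρ.IsUnramifiedAt v) →
        (∀ (v : HeightOneSpectrum (𝓞 F)) (hv : ((p : ℕ) : 𝓞 F) ∈ v.asIdeal),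
          let D := fontainePstAdicCompletion v p hv
          D.IsCrystallineFramed (ρ.toLocal v) ∧
            (letI := D.algebra
             ∀ τ' : v.adicCompletion F →ₐ[ℚ_[p]] PadicAlgCl p,
               ρ.labelledHodgeTateWeightsAt v D.algebra D.𝔅 τ'.toRingHom =
                 (Multiset.range 2).map fun i : ℕ => (i : ℤ))) →
        ρ.IsResidualRepOf (RingHom.id _) τ → IsAbsIrreducible τ → IsDecomposedGeneric τ →
        IsAbsIrreducible (τ.comp (absGaloisGroupAdjoinRootsOfUnity F p).subtype) →
        Subgroup.IsEnormous ((absGaloisGroupAdjoinRootsOfUnity F p).map τ) →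
        (∃ σ : absoluteGaloisGroup F, σ ∉ absGaloisGroupAdjoinRootsOfUnity F p ∧
          ∃ c : padicAlgClResidueField p,
            ((τ σ : GL (Fin 2) (padicAlgClResidueField p)) :
              Matrix (Fin 2) (Fin 2) (padicAlgClResidueField p)) = c • (1 : Matrix _ _ _)) →
        π₀.1.HasWeightZero → HLTT.IsCompatible π₀.1 ι r₀ →
        r₀.IsResidualRepOf (RingHom.id _) τ →
        (∀ v : HeightOneSpectrum (𝓞 F), ((p : ℕ) : 𝓞 F) ∈ v.asIdeal → π₀.1.IsUnramifiedAt v) →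
        ∃ Pi : CuspidalAutomorphicRepData 2 F hcpt,
          Pi.1.HasWeightZero ∧ HLTT.IsCompatible Pi.1 ι ρ := by
  intro F _ _ _ _hc hCM hcpt p _ hp hunr ι ρ τ π₀ r₀ h1 h2 h3 h4 h5 h6 h7 h8 h9 h10 h11 h12
  obtain ⟨Pi, hPi, hcomp, -, -⟩ := h611 F (Or.inr hCM) 2 hcpt p (by omega) (by omega) hunr ι ρ τ π₀ r₀
    h1 h2 h3 h4 h5 h6 h7 h8 h9 h10 h11 h12
  exact ⟨Pi, hPi, hcomp⟩

end Summit.Langlands.Langlands.Cruxes.VoidToLanglands.SatakeSectorCut.Sketch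

end
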